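import Summits.BirchSwinnertonDyer.BirchSwinnertonDyer.Theorems.ByReductionTypeAtTwoOrdKatoHalfAtTwoIsoSteinbergSahTwist
import Summits.BirchSwinnertonDyer.BirchSwinnertonDyer.Theorems.ByReductionTypeAtTwoOrdKatoHalfAtTwoIsoResidueConj
import Summits.BirchSwinnertonDyer.BirchSwinnertonDyer.Theorems.ByReductionTypeAtTwoOrdKatoHalfAtTwoIsoResidueImage
import Literature.NumberTheory.IwasawaTheory.ClassicalMuInvariantOnePrimeProofs
import HarnessLib

/-!
# Route ByReductionTypeAtTwo, crux `OrdKatoHalfAtTwoIso` (stmt-BirchSwinnertonDyer-19573), line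
# `steinberg-fibre-at-two`: the Steinberg–Sah lemma ON THE RESIDUE — hypotheses `ρ̄_{E,2}` onto and `Δ < 0` only
# (PORT-MAP site P1 at `p = 2`, assembled: the 3-cycle `σ₀ ∈ Gal(ℚ̄/ℚ_∞)` is DISCHARGED)

Seat `cruxlead-stmt-BirchSwinnertonDyer-19573-g0` (LEAD PROVER, MODE LINE). HONEST FRAMING (cell bsd-2adic): BSD is not proved by
any of this; the crux is not proved here; theorems only; `--supports stmt-BirchSwinnertonDyer-19573 --as helper`.

ASSEMBLY. On the habitat of socket 1 (`ρ̄_{E,2}` onto `GL₂(𝔽₂)`, `Δ < 0`; any `ℤ₂`-extension `κ` of `ℚ`): a complex conjugation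
`c ∈ Γ_ℚ` exists (`exists_isComplexConjugation`), lies in `ker κ` (`ZpExtension.mem_kerSubgroup_of_isComplexConjugation`: `κ(c)` is
`2`-torsion in the torsion-free `ℤ₂`), and is a TRANSPOSITION on `E[2]` because `Δ < 0` (wave-1 helper p657370
`sign_permGal_eq_neg_one_of_isComplexConjugation_of_Δ_neg`); a normal subgroup of `S₃` containing a transposition is `S₃`, so
`ρ̄₂(ker κ) = S₃` and some `σ₀ ∈ ker κ` is a 3-cycle, i.e. fixes no non-zero point of `E[2]` (wave-1 helper p657099
`exists_mem_kerSubgroup_forall_smul_ne`). Feeding `σ₀` to the Steinberg–Sah lemma on `𝒯_J(E)` (p657595) gives the four statements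
below — the `p = 2`, DD12-residue replacements of `…X9CentralScalarOdd :148/:159/:170/:181` with `(p ≠ 2, Irr, ¬Surj)` replaced by
`(ρ̄₂ onto, Δ < 0)`; NO scalar, NO `σ₀` left in the hypotheses.

* `exists_mem_kerSubgroup_noFixedPoint_of_residue` — `∃ σ₀ ∈ ker κ, ∀ P ≠ 0, σ₀ • P ≠ P`.
* `modPTwist_two_oneCocycleClass_eq_of_forall_mem_eq_of_residue`, `…eq_zero…`, `…layerSubgroup…`,
  `invTwist_modPTwist_two_oneCocycleClass_eq_of_forall_mem_eq_of_residue`.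

References: Sah 1968 Prop. 2.7 (b); Serre 1972 §2.6; Silverman AEC III.§7; the line's helpers p656928, p657099, p657370, p657595;
`Cruxes/OrdKatoHalfAtTwoIso/PORT-MAP-stub_port.md` (P1).
-/

set_option autoImplicit false
set_option linter.dupNamespace false

noncomputable section

open Field WeierstrassCurve Function
open Literature.NumberTheory.EllipticCurves Literature.NumberTheory.GaloisRepresentations
open Literature.NumberTheory.EllipticCurves.DokchitserDokchitser2012
open Summit.BirchSwinnertonDyer.BirchSwinnertonDyer.Rank1Residual

namespace Summit.BirchSwinnertonDyer.BirchSwinnertonDyer.Theorems.SteinbergFibreAtTwo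

variable (W : WeierstrassCurve ℚ) [W.IsElliptic] (κ : ZpExtension ℚ 2)

/-- **A 3-cycle inside `Gal(ℚ̄/ℚ_∞)` on the residue**: if `ρ̄_{E,2}` is onto and `Δ < 0` then for EVERY `ℤ₂`-extension `κ`
of `ℚ` some `σ₀ ∈ ker κ` fixes no non-zero `2`-torsion point (complex conjugation is a transposition in `ker κ`; a normal
subgroup of `S₃` containing a transposition is everything). [cite: SilvermanAEC2009, III.§7] [cite: Washington1997, §13.1] -/
theorem exists_mem_kerSubgroup_noFixedPoint_of_residue (h2 : W.HasSurjectiveModNGaloisRep 2) (hΔ : W.Δ < 0) :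
    ∃ σ₀ ∈ κ.kerSubgroup, ∀ P : geomTorsion W 2, P ≠ 0 → σ₀ • P ≠ P := by
  obtain ⟨c, hc⟩ := exists_isComplexConjugation (Rat.castHom ℝ)
  exact exists_mem_kerSubgroup_forall_smul_ne W κ h2
    (ZpExtension.mem_kerSubgroup_of_isComplexConjugation κ hc)
    (sign_permGal_eq_neg_one_of_isComplexConjugation_of_Δ_neg W hc hΔ)

/-- **Steinberg–Sah on the residue, injectivity form** (`p = 2` replacement of `…X9CentralScalarOdd:148`): for `ρ̄₂` onto and
`Δ < 0`, two continuous 1-cocycles of `𝒯_J(E) = W.modPTwist 2 κ J` agreeing on `ker ρ̄_{E,2} ⊓ ker κ` have the same class.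
[cite: Sah1968, Prop. 2.7 (b) and its proof, p. 60] [cite: Serre1972, §2.6] -/
theorem modPTwist_two_oneCocycleClass_eq_of_forall_mem_eq_of_residue (h2 : W.HasSurjectiveModNGaloisRep 2)
    (hΔ : W.Δ < 0) (J : ℕ) (φ ψ : contOneCocycles (W.modPTwist 2 κ J).toTopRep)
    (hN : ∀ ν ∈ (galoisRepTorsion W 2).ker ⊓ κ.kerSubgroup, φ.1 ν = ψ.1 ν) :
    oneCocycleClass _ φ = oneCocycleClass _ ψ := by
  obtain ⟨σ₀, hκ, hσ₀⟩ := exists_mem_kerSubgroup_noFixedPoint_of_residue W κ h2 hΔ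
  exact modPTwist_two_oneCocycleClass_eq_of_forall_mem_eq_of_noFixedPoint W κ hκ hσ₀ J φ ψ hN

/-- **Vanishing form on the residue** (`p = 2` replacement of `…X9CentralScalarOdd:159`).
[cite: Sah1968, Prop. 2.7 (b) and its proof, p. 60] [cite: Serre1972, §2.6] -/
theorem modPTwist_two_oneCocycleClass_eq_zero_of_forall_mem_eq_zero_of_residue (h2 : W.HasSurjectiveModNGaloisRep 2)
    (hΔ : W.Δ < 0) (J : ℕ) (φ : contOneCocycles (W.modPTwist 2 κ J).toTopRep)
    (hN : ∀ ν ∈ (galoisRepTorsion W 2).ker ⊓ κ.kerSubgroup, φ.1 ν = 0) :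
    oneCocycleClass _ φ = 0 := by
  obtain ⟨σ₀, hκ, hσ₀⟩ := exists_mem_kerSubgroup_noFixedPoint_of_residue W κ h2 hΔ
  exact modPTwist_two_oneCocycleClass_eq_zero_of_forall_mem_eq_zero_of_noFixedPoint W κ hκ hσ₀ J φ hN

/-- **Layer form on the residue** (`p = 2` replacement of `…X9CentralScalarOdd:170`).
[cite: Sah1968, Prop. 2.7 (b) and its proof, p. 60] [cite: Washington1997, §13.1] -/
theorem modPTwist_two_oneCocycleClass_eq_of_forall_mem_layerSubgroup_eq_of_residue
    (h2 : W.HasSurjectiveModNGaloisRep 2) (hΔ : W.Δ < 0) (J n : ℕ)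
    (φ ψ : contOneCocycles (W.modPTwist 2 κ J).toTopRep)
    (hN : ∀ ν ∈ (galoisRepTorsion W 2).ker ⊓ κ.layerSubgroup n, φ.1 ν = ψ.1 ν) :
    oneCocycleClass _ φ = oneCocycleClass _ ψ := by
  obtain ⟨σ₀, hκ, hσ₀⟩ := exists_mem_kerSubgroup_noFixedPoint_of_residue W κ h2 hΔ
  exact modPTwist_two_oneCocycleClass_eq_of_forall_mem_layerSubgroup_eq_of_noFixedPoint W κ hκ hσ₀ J n φ ψ hN

/-- **Dual-twist form on the residue** (`p = 2` replacement of `…X9CentralScalarOdd:181`).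
[cite: Sah1968, Prop. 2.7 (b) and its proof, p. 60] [cite: Washington1997, §13.1] -/
theorem invTwist_modPTwist_two_oneCocycleClass_eq_of_forall_mem_eq_of_residue
    (h2 : W.HasSurjectiveModNGaloisRep 2) (hΔ : W.Δ < 0) (J : ℕ)
    (φ ψ : contOneCocycles (W.modPTwist 2 κ.invTwist J).toTopRep)
    (hN : ∀ ν ∈ (galoisRepTorsion W 2).ker ⊓ κ.kerSubgroup, φ.1 ν = ψ.1 ν) :
    oneCocycleClass _ φ = oneCocycleClass _ ψ := by
  obtain ⟨σ₀, hκ, hσ₀⟩ := exists_mem_kerSubgroup_noFixedPoint_of_residue W κ h2 hΔ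
  exact invTwist_modPTwist_two_oneCocycleClass_eq_of_forall_mem_eq_of_noFixedPoint W κ hκ hσ₀ J φ ψ hN

end Summit.BirchSwinnertonDyer.BirchSwinnertonDyer.Theorems.SteinbergFibreAtTwo

end
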